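import Summits.Ventures.Crystal3D.Theorems.StickyWulffConstantTextureLiminfTexShadowBothFccFirstDefs
import HarnessLib

/-!
# TexShadow v8.1 vocabulary — the faulted stubs and the way stations WITHOUT the residual-class hypothesis `hgen`
# (lane T, crux `TextureLiminfV5`, stmt-Ventures-23912; wulff-p2's proposal to cf-p1 g30, 2026-08-29T02:2xZ, after DECISION (lxxxii) and 19480-p2's Q1(b) = NO)

HONEST FRAMING. Venture `Summits/Ventures/Crystal3D` (cell `crystal3d-full`), route `route-Ventures-StickyWulffConstant`, helper
`--supports` the law-v5 crux `TextureLiminfV5` (stmt-Ventures-23912).  DEFINITIONS + one-line inclusions only; nothing about any wall law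
is proved or claimed; rung F-C1 not moved.

THE POINT.  Every cell class of the T-side wall vocabulary (v6.4 → v8) carries the hypothesis
`hgen : ∀ i j, ¬ InResidualClass (A₁ i) (A₂ j) (u₁ i) (u₂ j)` («no facing bilayer-frame pair lies in lane G's registered residual»), the
complement being the RESIDUAL stub.  In v6.x `hgen`'s only consumer was the (β) sort routing a non-co-axial fcc frame pair to the priced
cells; at law v5 lane G's charge-`c₀` ledger prices all of them, and every CLOSED part of the faulted branch (walker-covered
`barlow_hlines_oriented`, row-covered `barlow_rowhlines_apart`, zig-frames-apart `barlow_hlines_zigApart`, `bilayerWallAt_of_payerBound`)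
never used `hgen`.  The v8 residual stub `BilayerWallResidualFaultedAt` (faulted pairs WITH a residual-class frame pair — NON-co-axial by
the class's first conjunct) has therefore no mechanism of its own: it is the generic branch again, minus a hypothesis nobody uses.
v8.1 = the three owed faulted stubs WITHOUT `hgen` (strictly stronger by an unused hypothesis) and NO residual stub.  This file types:
* the owed stubs, `hgen`-free: `BilayerWallFaultedOnReachCoaxialFreeAt`, `BilayerWallFaultedZigCoaxialFreeAt`, `HStripPayerPoolFaultedFreeAt`
  (`c₀ C R₀`; = the v8 At-defs with the line `(∀ i j, ¬ InResidualClass …) →` deleted);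
* the way stations, `hgen`-free: `BilayerWallOnReachCoaxialFreeAt`, `BilayerWallZigCoaxialFreeAt`, `BilayerWallOnReachWeakZigFreeAt`,
  `BilayerWallOnReachAllFreeAt OffR`, `BilayerWallDeficitMinFreeAt`, and `BilayerWallAllAt c₀ C R₀` — the WHOLE law at cap `c₀` in
  frames-∀ form (every presented pair with bilayer frames and a `c₀`-admissible table: the cell), from which `BilayerWallCharged c₀` is one step;
* inclusions free ⇒ v8 (`faultedOnReachCoaxialAt_of_free`, `faultedZigCoaxialAt_of_free`, `hStripPayerPoolFaultedAt_of_free`,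
  `residualFaultedAt_of_allAt`, `genericAt_of_allAt`): the v8 registered stubs follow from the v8.1 ones.
The glue `bilayerWallV5_of_stubsBothFccFirstFree` is the next file (`…TexShadowFreeGlue`).
WHAT THIS IS NOT: no proof of any wall law; F-C1 not moved.
-/

noncomputable section

open scoped BigOperators InnerProductSpace ENNReal
open MeasureTheory Filter

namespace Summit.Ventures.Crystal3D.Cruxes.TextureLiminf.TexShadow

open Summit.Ventures.Crystal3D Summit.Ventures.Crystal3D.Theorems
open Literature.MathematicalPhysics.StatisticalMechanics (IsHaggSeq fccStacking barlowStacking contactDeficiency basalMirror)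

/-! ## The three owed faulted stubs without `hgen` -/

/-- **T-F2, corner-keyed half, at cap `c₀`, faulted pairs, NO residual-class hypothesis** (`BilayerWallFaultedOnReachCoaxialAt` minus `hgen`). -/
def BilayerWallFaultedOnReachCoaxialFreeAt (c₀ C R₀ : ℝ) : Prop :=
  ∀ (σ₁ σ₂ : ℤ → ℤ), IsHaggSeq σ₁ → IsHaggSeq σ₂ → ¬ BothFcc σ₁ σ₂ →
    ∀ (L₁ L₂ : E3 ≃ₗᵢ[ℝ] E3) (s₁ s₂ : E3) (A₁ A₂ : ℤ → (E3 ≃ₗᵢ[ℝ] E3)) (u₁ u₂ : ℤ → E3),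
    BilayerFramesAt L₁ s₁ σ₁ A₁ u₁ → BilayerFramesAt L₂ s₂ σ₂ A₂ u₂ →
    ∀ (c : ℤ → ℤ → ℝ) (m : ℤ → ℤ → E3), BilayerChargeAdmissibleAt c₀ A₁ A₂ c m → DomBy L₁ σ₁ L₂ σ₂ c →
      (∃ F₁ ∈ cornerFrames L₁ σ₁ e₃, ∃ F₂ ∈ cornerFrames L₂ σ₂ (-e₃), CoAxFrames F₁ F₂) →
      BilayerWallAt C R₀ σ₁ σ₂ L₁ L₂ s₁ s₂ c

/-- **T-F2, zig-keyed half, at cap `c₀`, faulted pairs, NO residual-class hypothesis** (`BilayerWallFaultedZigCoaxialAt` minus `hgen`). -/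
def BilayerWallFaultedZigCoaxialFreeAt (c₀ C R₀ : ℝ) : Prop :=
  ∀ (σ₁ σ₂ : ℤ → ℤ), IsHaggSeq σ₁ → IsHaggSeq σ₂ → ¬ BothFcc σ₁ σ₂ →
    ∀ (L₁ L₂ : E3 ≃ₗᵢ[ℝ] E3) (s₁ s₂ : E3) (A₁ A₂ : ℤ → (E3 ≃ₗᵢ[ℝ] E3)) (u₁ u₂ : ℤ → E3),
    BilayerFramesAt L₁ s₁ σ₁ A₁ u₁ → BilayerFramesAt L₂ s₂ σ₂ A₂ u₂ →
    ∀ (c : ℤ → ℤ → ℝ) (m : ℤ → ℤ → E3), BilayerChargeAdmissibleAt c₀ A₁ A₂ c m →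
      DeltaSteep L₁ e₃ → DeltaSteep L₂ (-e₃) → FluxDominated (Real.sqrt 2 / 2) L₁ σ₁ L₂ σ₂ c →
      ¬ BarlowOffReach L₁ s₁ σ₁ L₂ s₂ σ₂ → ¬ RowMixDominated (Real.sqrt 2 / 2) L₁ σ₁ L₂ σ₂ c →
      ¬ (ZigGood L₁ σ₁ e₃ ∧ ZigGood L₂ σ₂ (-e₃)) →
      (∃ F₁ ∈ zigFrames L₁ e₃, ∃ F₂ ∈ zigFrames L₂ (-e₃), CoAxFrames F₁ F₂) →
      BilayerWallAt C R₀ σ₁ σ₂ L₁ L₂ s₁ s₂ c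

open scoped Classical in
/-- **Deficit-MIN PAYER POOL at cap `c₀`, faulted pairs, NO residual-class hypothesis** (`HStripPayerPoolFaultedAt` minus `hgen`). -/
def HStripPayerPoolFaultedFreeAt (c₀ C R₀ : ℝ) : Prop :=
  ∀ (σ₁ σ₂ : ℤ → ℤ), IsHaggSeq σ₁ → IsHaggSeq σ₂ → ¬ BothFcc σ₁ σ₂ →
    ∀ (L₁ L₂ : E3 ≃ₗᵢ[ℝ] E3) (s₁ s₂ : E3) (A₁ A₂ : ℤ → (E3 ≃ₗᵢ[ℝ] E3)) (u₁ u₂ : ℤ → E3),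
    BilayerFramesAt L₁ s₁ σ₁ A₁ u₁ → BilayerFramesAt L₂ s₂ σ₂ A₂ u₂ →
    ∀ (c : ℤ → ℤ → ℝ) (m : ℤ → ℤ → E3), BilayerChargeAdmissibleAt c₀ A₁ A₂ c m →
      ¬ (DeltaSteep L₁ e₃ ∧ DeltaSteep L₂ (-e₃) ∧ FluxDominated (Real.sqrt 2 / 2) L₁ σ₁ L₂ σ₂ c) →
      ¬ RowMixDominated (Real.sqrt 2 / 2) L₁ σ₁ L₂ σ₂ c →
      ¬ RowMixDominated (Real.sqrt 2 / 2) (basalMirror.trans L₁) (fun n => -σ₁ (-n - 1)) L₂ σ₂ (fun i j => c (-i - 1) j) →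
      ¬ RowMixDominated (Real.sqrt 2 / 2) L₁ σ₁ (basalMirror.trans L₂) (fun n => -σ₂ (-n - 1)) (fun i j => c i (-j - 1)) →
      ¬ RowMixDominated (Real.sqrt 2 / 2) (basalMirror.trans L₁) (fun n => -σ₁ (-n - 1))
          (basalMirror.trans L₂) (fun n => -σ₂ (-n - 1)) (fun i j => c (-i - 1) (-j - 1)) →
      ∀ h : ℝ, 0 ≤ h → ∀ ρ : ℝ, R₀ ≤ ρ → ∀ X P₁ P₂ : Finset E3,
        (∀ p ∈ X, ∀ q ∈ X, p ≠ q → 1 ≤ dist p q) → P₁ ⊆ X → P₂ ⊆ X \ P₁ → (∀ p ∈ X, p ∈ cyl R₀ h ρ) →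
        (∀ p, p ∈ P₁ ↔ (p ∈ stacking L₁ s₁ σ₁ ∧ -(2 * R₀) ≤ p 2 ∧ p 2 ≤ -R₀ ∧ p 0 ^ 2 + p 1 ^ 2 ≤ ρ ^ 2)) →
        (∀ p, p ∈ P₂ ↔ (p ∈ stacking L₂ s₂ σ₂ ∧ h + R₀ ≤ p 2 ∧ p 2 ≤ h + 2 * R₀ ∧ p 0 ^ 2 + p 1 ^ 2 ≤ ρ ^ 2)) →
        2 * (∑' ij : ℤ × ℤ, c ij.1 ij.2 *
            (volume ({q : E3 | 0 ≤ q 2 ∧ q 2 ≤ 1 ∧ q 0 ^ 2 + q 1 ^ 2 ≤ ρ ^ 2} ∩ laySlab L₁ s₁ ij.1 ∩ laySlab L₂ s₂ ij.2)).toReal) ≤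
          (∑ y ∈ X.filter (fun y => (X.filter fun q => dist y q = 1).card ≠ 12 ∧ -R₀ - 2 ≤ y 2 ∧ y 2 ≤ h + R₀ + 2),
            ((12 : ℝ) - ((X.filter fun q => dist y q = 1).card : ℝ))) + C * (1 + h) * ρ

/-! ## The way stations without `hgen` -/

/-- O3 at cap `c₀`, NO residual-class hypothesis (`BilayerWallOnReachCoaxialAt` minus `hgen`). -/
def BilayerWallOnReachCoaxialFreeAt (c₀ C R₀ : ℝ) : Prop :=
  ∀ (σ₁ σ₂ : ℤ → ℤ), IsHaggSeq σ₁ → IsHaggSeq σ₂ →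
    ∀ (L₁ L₂ : E3 ≃ₗᵢ[ℝ] E3) (s₁ s₂ : E3) (A₁ A₂ : ℤ → (E3 ≃ₗᵢ[ℝ] E3)) (u₁ u₂ : ℤ → E3),
    BilayerFramesAt L₁ s₁ σ₁ A₁ u₁ → BilayerFramesAt L₂ s₂ σ₂ A₂ u₂ →
    ∀ (c : ℤ → ℤ → ℝ) (m : ℤ → ℤ → E3), BilayerChargeAdmissibleAt c₀ A₁ A₂ c m → DomBy L₁ σ₁ L₂ σ₂ c →
      (∃ F₁ ∈ cornerFrames L₁ σ₁ e₃, ∃ F₂ ∈ cornerFrames L₂ σ₂ (-e₃), CoAxFrames F₁ F₂) →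
      BilayerWallAt C R₀ σ₁ σ₂ L₁ L₂ s₁ s₂ c

/-- ZO3 at cap `c₀`, NO residual-class hypothesis (`BilayerWallZigCoaxialAt` minus `hgen`). -/
def BilayerWallZigCoaxialFreeAt (c₀ C R₀ : ℝ) : Prop :=
  ∀ (σ₁ σ₂ : ℤ → ℤ), IsHaggSeq σ₁ → IsHaggSeq σ₂ →
    ∀ (L₁ L₂ : E3 ≃ₗᵢ[ℝ] E3) (s₁ s₂ : E3) (A₁ A₂ : ℤ → (E3 ≃ₗᵢ[ℝ] E3)) (u₁ u₂ : ℤ → E3),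
    BilayerFramesAt L₁ s₁ σ₁ A₁ u₁ → BilayerFramesAt L₂ s₂ σ₂ A₂ u₂ →
    ∀ (c : ℤ → ℤ → ℝ) (m : ℤ → ℤ → E3), BilayerChargeAdmissibleAt c₀ A₁ A₂ c m →
      DeltaSteep L₁ e₃ → DeltaSteep L₂ (-e₃) → FluxDominated (Real.sqrt 2 / 2) L₁ σ₁ L₂ σ₂ c →
      ¬ BarlowOffReach L₁ s₁ σ₁ L₂ s₂ σ₂ → ¬ RowMixDominated (Real.sqrt 2 / 2) L₁ σ₁ L₂ σ₂ c →
      ¬ (ZigGood L₁ σ₁ e₃ ∧ ZigGood L₂ σ₂ (-e₃)) →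
      (∃ F₁ ∈ zigFrames L₁ e₃, ∃ F₂ ∈ zigFrames L₂ (-e₃), CoAxFrames F₁ F₂) →
      BilayerWallAt C R₀ σ₁ σ₂ L₁ L₂ s₁ s₂ c

/-- W at cap `c₀`, NO residual-class hypothesis (`BilayerWallOnReachWeakZigAt` minus `hgen`). -/
def BilayerWallOnReachWeakZigFreeAt (c₀ C R₀ : ℝ) : Prop :=
  ∀ (σ₁ σ₂ : ℤ → ℤ), IsHaggSeq σ₁ → IsHaggSeq σ₂ →
    ∀ (L₁ L₂ : E3 ≃ₗᵢ[ℝ] E3) (s₁ s₂ : E3) (A₁ A₂ : ℤ → (E3 ≃ₗᵢ[ℝ] E3)) (u₁ u₂ : ℤ → E3),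
    BilayerFramesAt L₁ s₁ σ₁ A₁ u₁ → BilayerFramesAt L₂ s₂ σ₂ A₂ u₂ →
    ∀ (c : ℤ → ℤ → ℝ) (m : ℤ → ℤ → E3), BilayerChargeAdmissibleAt c₀ A₁ A₂ c m →
      DeltaSteep L₁ e₃ → DeltaSteep L₂ (-e₃) → FluxDominated (Real.sqrt 2 / 2) L₁ σ₁ L₂ σ₂ c →
      ¬ BarlowOffReach L₁ s₁ σ₁ L₂ s₂ σ₂ → ¬ RowMixDominated (Real.sqrt 2 / 2) L₁ σ₁ L₂ σ₂ c →
      ¬ (ZigGood L₁ σ₁ e₃ ∧ ZigGood L₂ σ₂ (-e₃)) →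
      BilayerWallAt C R₀ σ₁ σ₂ L₁ L₂ s₁ s₂ c

/-- On-reach part at cap `c₀` for the off-reach predicate `OffR`, NO residual-class hypothesis (`BilayerWallOnReachAllAt` minus `hgen`). -/
def BilayerWallOnReachAllFreeAt (OffR : (E3 ≃ₗᵢ[ℝ] E3) → E3 → (ℤ → ℤ) → (E3 ≃ₗᵢ[ℝ] E3) → E3 → (ℤ → ℤ) → Prop)
    (c₀ C R₀ : ℝ) : Prop :=
  ∀ (σ₁ σ₂ : ℤ → ℤ), IsHaggSeq σ₁ → IsHaggSeq σ₂ →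
    ∀ (L₁ L₂ : E3 ≃ₗᵢ[ℝ] E3) (s₁ s₂ : E3) (A₁ A₂ : ℤ → (E3 ≃ₗᵢ[ℝ] E3)) (u₁ u₂ : ℤ → E3),
    BilayerFramesAt L₁ s₁ σ₁ A₁ u₁ → BilayerFramesAt L₂ s₂ σ₂ A₂ u₂ →
    ∀ (c : ℤ → ℤ → ℝ) (m : ℤ → ℤ → E3), BilayerChargeAdmissibleAt c₀ A₁ A₂ c m →
      ((DeltaSteep L₁ e₃ ∧ DeltaSteep L₂ (-e₃) ∧ FluxDominated (Real.sqrt 2 / 2) L₁ σ₁ L₂ σ₂ c ∧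
          ¬ BarlowOffReach L₁ s₁ σ₁ L₂ s₂ σ₂) ∨
        (RowMixDominated (Real.sqrt 2 / 2) L₁ σ₁ L₂ σ₂ c ∧ ¬ OffR L₁ s₁ σ₁ L₂ s₂ σ₂)) →
      BilayerWallAt C R₀ σ₁ σ₂ L₁ L₂ s₁ s₂ c

/-- Deficit-MIN at cap `c₀`, NO residual-class hypothesis (`BilayerWallDeficitMinAt` minus `hgen`). -/
def BilayerWallDeficitMinFreeAt (c₀ C R₀ : ℝ) : Prop :=
  ∀ (σ₁ σ₂ : ℤ → ℤ), IsHaggSeq σ₁ → IsHaggSeq σ₂ →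
    ∀ (L₁ L₂ : E3 ≃ₗᵢ[ℝ] E3) (s₁ s₂ : E3) (A₁ A₂ : ℤ → (E3 ≃ₗᵢ[ℝ] E3)) (u₁ u₂ : ℤ → E3),
    BilayerFramesAt L₁ s₁ σ₁ A₁ u₁ → BilayerFramesAt L₂ s₂ σ₂ A₂ u₂ →
    ∀ (c : ℤ → ℤ → ℝ) (m : ℤ → ℤ → E3), BilayerChargeAdmissibleAt c₀ A₁ A₂ c m →
      ¬ (DeltaSteep L₁ e₃ ∧ DeltaSteep L₂ (-e₃) ∧ FluxDominated (Real.sqrt 2 / 2) L₁ σ₁ L₂ σ₂ c) →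
      ¬ RowMixDominated (Real.sqrt 2 / 2) L₁ σ₁ L₂ σ₂ c →
      ¬ RowMixDominated (Real.sqrt 2 / 2) (basalMirror.trans L₁) (fun n => -σ₁ (-n - 1)) L₂ σ₂ (fun i j => c (-i - 1) j) →
      ¬ RowMixDominated (Real.sqrt 2 / 2) L₁ σ₁ (basalMirror.trans L₂) (fun n => -σ₂ (-n - 1)) (fun i j => c i (-j - 1)) →
      ¬ RowMixDominated (Real.sqrt 2 / 2) (basalMirror.trans L₁) (fun n => -σ₁ (-n - 1))
          (basalMirror.trans L₂) (fun n => -σ₂ (-n - 1)) (fun i j => c (-i - 1) (-j - 1)) →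
      BilayerWallAt C R₀ σ₁ σ₂ L₁ L₂ s₁ s₂ c

/-- **THE WHOLE WALL LAW AT CAP `c₀` IN FRAMES-∀ FORM** (`BilayerWallGenericAt` minus `hgen`): every presented Barlow pair with bilayer frames
and a `c₀`-admissible table satisfies the cell at `(C, R₀)`.  `BilayerWallCharged c₀` is one step away (`bilayerWallCharged_of_allAt`). -/
def BilayerWallAllAt (c₀ C R₀ : ℝ) : Prop :=
  ∀ (σ₁ σ₂ : ℤ → ℤ), IsHaggSeq σ₁ → IsHaggSeq σ₂ →
    ∀ (L₁ L₂ : E3 ≃ₗᵢ[ℝ] E3) (s₁ s₂ : E3) (A₁ A₂ : ℤ → (E3 ≃ₗᵢ[ℝ] E3)) (u₁ u₂ : ℤ → E3),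
    BilayerFramesAt L₁ s₁ σ₁ A₁ u₁ → BilayerFramesAt L₂ s₂ σ₂ A₂ u₂ →
    ∀ (c : ℤ → ℤ → ℝ) (m : ℤ → ℤ → E3), BilayerChargeAdmissibleAt c₀ A₁ A₂ c m →
      BilayerWallAt C R₀ σ₁ σ₂ L₁ L₂ s₁ s₂ c

/-! ## Inclusions: the v8.1 (`hgen`-free) statements give the v8 ones -/

/-- Free ⇒ v8, T-F2 corner key. -/
theorem faultedOnReachCoaxialAt_of_free {c₀ C R₀ : ℝ} (h : BilayerWallFaultedOnReachCoaxialFreeAt c₀ C R₀) :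
    BilayerWallFaultedOnReachCoaxialAt c₀ C R₀ :=
  fun σ₁ σ₂ hσ₁ hσ₂ hf L₁ L₂ s₁ s₂ A₁ A₂ u₁ u₂ hA₁ hA₂ _ => h σ₁ σ₂ hσ₁ hσ₂ hf L₁ L₂ s₁ s₂ A₁ A₂ u₁ u₂ hA₁ hA₂

/-- Free ⇒ v8, T-F2 zig key. -/
theorem faultedZigCoaxialAt_of_free {c₀ C R₀ : ℝ} (h : BilayerWallFaultedZigCoaxialFreeAt c₀ C R₀) :
    BilayerWallFaultedZigCoaxialAt c₀ C R₀ :=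
  fun σ₁ σ₂ hσ₁ hσ₂ hf L₁ L₂ s₁ s₂ A₁ A₂ u₁ u₂ hA₁ hA₂ _ => h σ₁ σ₂ hσ₁ hσ₂ hf L₁ L₂ s₁ s₂ A₁ A₂ u₁ u₂ hA₁ hA₂

/-- Free ⇒ v8, faulted payer pool. -/
theorem hStripPayerPoolFaultedAt_of_free {c₀ C R₀ : ℝ} (h : HStripPayerPoolFaultedFreeAt c₀ C R₀) :
    HStripPayerPoolFaultedAt c₀ C R₀ :=
  fun σ₁ σ₂ hσ₁ hσ₂ hf L₁ L₂ s₁ s₂ A₁ A₂ u₁ u₂ hA₁ hA₂ _ => h σ₁ σ₂ hσ₁ hσ₂ hf L₁ L₂ s₁ s₂ A₁ A₂ u₁ u₂ hA₁ hA₂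

/-- The whole law in frames-∀ form gives the generic part at cap `c₀` (drop `hgen`) … -/
theorem genericAt_of_allAt {c₀ C R₀ : ℝ} (h : BilayerWallAllAt c₀ C R₀) : BilayerWallGenericAt c₀ C R₀ :=
  fun σ₁ σ₂ hσ₁ hσ₂ L₁ L₂ s₁ s₂ A₁ A₂ u₁ u₂ hA₁ hA₂ _ => h σ₁ σ₂ hσ₁ hσ₂ L₁ L₂ s₁ s₂ A₁ A₂ u₁ u₂ hA₁ hA₂

/-- … the residual part at cap `c₀` … -/
theorem residualAt_of_allAt {c₀ C R₀ : ℝ} (h : BilayerWallAllAt c₀ C R₀) : BilayerWallResidualAt c₀ C R₀ :=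
  fun σ₁ σ₂ hσ₁ hσ₂ L₁ L₂ s₁ s₂ A₁ A₂ u₁ u₂ hA₁ hA₂ _ => h σ₁ σ₂ hσ₁ hσ₂ L₁ L₂ s₁ s₂ A₁ A₂ u₁ u₂ hA₁ hA₂

/-- … the v8 faulted residual stub … -/
theorem residualFaultedAt_of_allAt {c₀ C R₀ : ℝ} (h : BilayerWallAllAt c₀ C R₀) : BilayerWallResidualFaultedAt c₀ C R₀ :=
  residualFaultedAt_of_residualAt (residualAt_of_allAt h)

/-- … and the `BothFcc` half. -/
theorem bothFccAt_of_allAt {c₀ C R₀ : ℝ} (h : BilayerWallAllAt c₀ C R₀) : BilayerWallBothFccAt c₀ C R₀ :=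
  fun σ₁ σ₂ hσ₁ hσ₂ _ => h σ₁ σ₂ hσ₁ hσ₂

/-- **`BilayerWallCharged c₀` from the frames-∀ form at one `R₀ ≥ 1`** (choose the frames, bundle the four table hypotheses). -/
theorem bilayerWallCharged_of_allAt {c₀ C R₀ : ℝ} (hR₀ : 1 ≤ R₀) (h : BilayerWallAllAt c₀ C R₀) : BilayerWallCharged c₀ := by
  classical
  refine ⟨C, R₀, hR₀, ?_⟩
  intro σ₁ σ₂ hσ₁ hσ₂ L₁ L₂ s₁ s₂ A₁ A₂ hA₁ hA₂ c m hc0 hc1 hc2 hc3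
  choose u₁ hu₁ using hA₁
  choose u₂ hu₂ using hA₂
  exact h σ₁ σ₂ hσ₁ hσ₂ L₁ L₂ s₁ s₂ A₁ A₂ u₁ u₂ hu₁ hu₂ c m ⟨hc0, hc1, hc2, hc3⟩

end Summit.Ventures.Crystal3D.Cruxes.TextureLiminf.TexShadow

end
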